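import Mathlib
import Summits.ValiantsHypothesis.ValiantsHypothesis.Theorems.FifoMatchingNNLowDegreeCofactorHardCofactorBuysVertices
import Summits.ValiantsHypothesis.ValiantsHypothesis.Theorems.FifoMatchingNNDivisionHardHyperDegree
import Summits.ValiantsHypothesis.ValiantsHypothesis.Theses.FifoMatching
import Literature.Computability.AlgebraicComplexity.NestFreeMatchingPoly
import HarnessLib

/-!
# Route FifoMatching — crux `NNDivisionHard` (stmt-ValiantsHypothesis-21181):
# the crux is its CHEAP, TORUS-HOMOGENEOUS, HYPER-DEGREE tier, by name

The torus `T = (ℝ_{>0})^{2n}` acts on the arc variables by `x_(i,j) ↦ t_i t_j x_(i,j)`; `NN_n` is a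
weight vector (every perfect matching touches every vertex once), and a cofactor `h` is a weight vector
iff all its monomials — multigraphs on `[2n]` — have ONE common vertex-degree vector
(`NNLowDegreeCofactorHard.vertexDeg`).  Passing from `h` to its top component for a generic vertex
potential `vertexWeight (2·deg h + 1)` is free for monotone circuits over `ℝ≥0`
(`ZeroOneTransfer.Negative.complexity_topComponent_le`, `topComponent_mul`,
`isWeightedHomogeneous_nestFreeMatchingPoly`) and lands in ONE weight space (base-`B` digits,
`eq_of_sum_mul_pow_eq`).  Together with the landed exponential rung `GridCorShadow.expRung_holds`
(cofactors of degree `≤ 2^⌊n^{1/8}⌋`) and the trivial remark that an expensive cofactor is its own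
certificate of hardness, the OPEN content of 21181 is exactly:

* ★ `nnDivisionHard_iff_torusTier` — `NNDivisionHard` ⟺ for every `c`, eventually in `n`, every
  nonzero cofactor `h` with (i) ONE vertex-degree vector for all its monomials, (ii) total degree
  `> 2^⌊n^{1/8}⌋`, (iii) `L₊(h) ≤ 2^((log₂ n + c)^c)`, has `2^((log₂ n + c)^c) < L₊(NN_n · h) + L₊(h)`.

So the residual cofactors are torus weight vectors of astronomically high multiplicity (degree beyond
`2^{n^{1/8}}` on at most `4n²` arcs) that are nevertheless cheap (repeated squaring).  Companion facts:
`HyperDegree.nnDivisionHard_iff_hyperDegree` (degree tier), `NNLowDegreeCofactorHard.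
nnDivisionHard_of_vertexSupport_budget` (few-vertices range), `ShadowCap.not_qp_shadow_bound_of_complexity`
(the planar-shadow engine has no degree-free form, HY21 Thm 30).

Honest framing: a by-name LOCALISATION of what is open (bookkeeping over landed engines), not progress on
the crux; `NNDivisionHard`, `NNNotVP`, `VP ≠ VNP` remain OPEN (NOT proved).  No definitions, no named facts.
-/

noncomputable section

-- Sub = Summit single-conjunct layout: the duplicated namespace component is mandated by the tree.
set_option linter.dupNamespace false
set_option autoImplicit false

namespace Summit.ValiantsHypothesis.ValiantsHypothesis.Theorems.FifoMatching.NNDivisionHard.TorusHomogeneous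

open MvPolynomial Literature.Computability.AlgebraicComplexity
open Summit.ValiantsHypothesis.ValiantsHypothesis.Theorems.ZeroOneTransfer.Negative
open Summit.ValiantsHypothesis.ValiantsHypothesis.Theorems.FifoMatching.NNLowDegreeCofactorHard
  (vertexWeight vertexDeg weight_vertexWeight vertexDeg_le isWeightedHomogeneous_nestFreeMatchingPoly)
open scoped NNReal

/-- **One vertex-degree vector on the top vertex-potential component.**  With `B = 2·deg h + 1`, all
monomials of `top_{vertexWeight B} h` have the same vertex-degree vector (base-`B` digits of the common
weight). [folklore] -/
theorem vertexDeg_eq_of_mem_topComponent {m : ℕ} (h : MvPolynomial (Fin m × Fin m) ℝ≥0)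
    {d d' : (Fin m × Fin m) →₀ ℕ}
    (hd : d ∈ (topComponent (vertexWeight (2 * h.totalDegree + 1)) h).support)
    (hd' : d' ∈ (topComponent (vertexWeight (2 * h.totalDegree + 1)) h).support) :
    vertexDeg d = vertexDeg d' := by
  classical
  set B := 2 * h.totalDegree + 1 with hB
  have hw : ∀ e ∈ (topComponent (vertexWeight B) h).support,
      Finsupp.weight (vertexWeight B) e = weightedTotalDegree (vertexWeight B) h := by
    intro e he
    have := mem_support_iff.mp he
    rw [coeff_topComponent] at this
    by_contra hne
    exact this (if_neg hne)
  have hlt : ∀ e ∈ (topComponent (vertexWeight B) h).support, ∀ v, vertexDeg e v < B := by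
    intro e he v
    have := le_totalDegree (support_topComponent_subset _ h he)
    have := vertexDeg_le e v
    omega
  exact eq_of_sum_mul_pow_eq (vertexDeg d) (vertexDeg d') (hlt d hd) (hlt d' hd')
    (by rw [← weight_vertexWeight, ← weight_vertexWeight, hw d hd, hw d' hd'])

/-- **The top vertex-potential component of the cofactor is free** (monotone circuits over `ℝ≥0`;
`NN_n` is homogeneous for every vertex potential): `L₊(NN_n · top h) ≤ L₊(NN_n · h)` and
`L₊(top h) ≤ L₊(h)`. [folklore] -/
theorem complexity_topVertexComponent_le (n B : ℕ) (h : MvPolynomial (Fin (2 * n) × Fin (2 * n)) ℝ≥0) :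
    complexity (nestFreeMatchingPoly n ℝ≥0 * topComponent (vertexWeight B) h) ≤
        complexity (nestFreeMatchingPoly n ℝ≥0 * h) ∧
      complexity (topComponent (vertexWeight B) h) ≤ complexity h := by
  refine ⟨?_, complexity_topComponent_le _ h⟩
  have hNN : topComponent (vertexWeight B) (nestFreeMatchingPoly n ℝ≥0) = nestFreeMatchingPoly n ℝ≥0 :=
    topComponent_eq_self_of_isWeightedHomogeneous _ (isWeightedHomogeneous_nestFreeMatchingPoly n B)
  have hmul : topComponent (vertexWeight B) (nestFreeMatchingPoly n ℝ≥0 * h) =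
      nestFreeMatchingPoly n ℝ≥0 * topComponent (vertexWeight B) h := by
    rw [topComponent_mul, hNN]
  rw [← hmul]
  exact complexity_topComponent_le _ _

/-- ★ **`NNDivisionHard` ⟺ its cheap, torus-homogeneous, hyper-degree tier.**  What is OPEN in
stmt-ValiantsHypothesis-21181 is exactly: quasi-polynomial certificates `L₊(NN_n · h) + L₊(h)` whose
nonzero cofactor `h` (i) has ONE vertex-degree vector for all its monomials (a torus weight vector),
(ii) has total degree `> 2^⌊n^{1/8}⌋`, and (iii) is itself cheap, `L₊(h) ≤ 2^((log₂ n + c)^c)`.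
[folklore] -/
theorem nnDivisionHard_iff_torusTier :
    Summit.ValiantsHypothesis.ValiantsHypothesis.Theses.FifoMatching.NNDivisionHard ↔
    ∀ c : ℕ, ∃ n₀ : ℕ, ∀ n ≥ n₀, ∀ h : MvPolynomial (Fin (2 * n) × Fin (2 * n)) ℝ≥0, h ≠ 0 →
      (∀ d ∈ h.support, ∀ d' ∈ h.support, vertexDeg d = vertexDeg d') →
      2 ^ Nat.sqrt (Nat.sqrt (Nat.sqrt n)) < h.totalDegree →
      complexity h ≤ 2 ^ ((Nat.log 2 n + c) ^ c) →
        2 ^ ((Nat.log 2 n + c) ^ c) < complexity (nestFreeMatchingPoly n ℝ≥0 * h) + complexity h := by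
  constructor
  · intro H c
    obtain ⟨n₀, hn₀⟩ := H c
    exact ⟨n₀, fun n hn h hh _ _ _ => hn₀ n hn h hh⟩
  · intro H c
    obtain ⟨n₀, hn₀⟩ := H c
    obtain ⟨n₁, hn₁⟩ := GridCorShadow.expRung_holds
    obtain ⟨n₂, hn₂⟩ := HyperDegree.polylog_le_root8 c
    refine ⟨max n₀ (max n₁ n₂), fun n hn h hh => ?_⟩
    have hn0 : n₀ ≤ n := le_trans (le_max_left _ _) hn
    have hn1 : n₁ ≤ n := le_trans ((le_max_left _ _).trans (le_max_right _ _)) hn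
    have hn2 : n₂ ≤ n := le_trans ((le_max_right _ _).trans (le_max_right _ _)) hn
    show 2 ^ ((Nat.log 2 n + c) ^ c) < complexity (nestFreeMatchingPoly n ℝ≥0 * h) + complexity h
    have hqp : 2 ^ ((Nat.log 2 n + c) ^ c) ≤ 2 ^ Nat.sqrt (Nat.sqrt (Nat.sqrt n)) :=
      Nat.pow_le_pow_right (by norm_num) (hn₂ n hn2)
    -- the free normalisation: the top vertex-potential component of `h`
    obtain ⟨hc1, hc2⟩ := complexity_topVertexComponent_le n (2 * h.totalDegree + 1) h
    set h' := topComponent (vertexWeight (2 * h.totalDegree + 1)) h with hh'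
    have hne : h' ≠ 0 := topComponent_ne_zero _ hh
    by_cases hdeg : h'.totalDegree ≤ 2 ^ Nat.sqrt (Nat.sqrt (Nat.sqrt n))
    · -- low degree: the exponential rung on `h'`
      have h1 := hn₁ n hn1 h' hne hdeg
      omega
    · by_cases hcost : complexity h' ≤ 2 ^ ((Nat.log 2 n + c) ^ c)
      · -- the tier on `h'`
        have h1 := hn₀ n hn0 h' hne (fun d hd d' hd' => vertexDeg_eq_of_mem_topComponent h hd hd')
          (lt_of_not_ge hdeg) hcost
        omega
      · -- an expensive cofactor certifies itself
        omega

end Summit.ValiantsHypothesis.ValiantsHypothesis.Theorems.FifoMatching.NNDivisionHard.TorusHomogeneous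

end
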